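import Summits.Ventures.PercRepro.Night2LocalForm

/-!
# PercRepro — the covering bound at a rank-`(q + 1)` flat (night-2, gen 6)

The local form `LocalShadowHall M q G` of `Night2LocalForm.lean` asks, at the rank-`(q + 1)` flat `G`, for
`(q+2)/(q+1) · Σ_{B} |G ∖ cl B| / |E ∖ cl B|` shadow sets with closure `G`.  This file proves the COVERING BOUND
at `G`: for `𝒜 ⊆ Uq M (q+2) q`, the sets `B ∪ {z}` with `B ∈ membersIn 𝒜 G` and `z ∈ G ∖ cl B` are shadow sets with
closure `G`, and each such set has at most `q + 1` preimages (a preimage is determined by a coloop of the set, and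
the coloops of a rank-`(q + 1)` set are independent), so

* **`sum_card_sdiff_le_card_shadowAt`**: `Σ_{B ∈ membersIn 𝒜 G} |G ∖ cl B| ≤ (q + 1) · #shadowAt 𝒜 G`;
* **`localShadowHall_of_thin`**: if every bottom set with closure inside `G` has at least `q + 2` ground elements
  outside its closure («thin» carrying hyperplanes), then `LocalShadowHall M q G` holds — the local analogue of
  the e-lemma.  The open case of the local form is therefore the flats `G` carrying a FAT hyperplane
  (`|E ∖ F| ≤ q + 1`), where the shadow sets `T ∪ Z` with `B ⊊ T ⊆ cl B` or `|Z| ≥ 2` must carry the deficit.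
-/

namespace PercRepro.Shadow

open Finset PerFlat ThmH

variable {α : Type*} [DecidableEq α] {M : Matroid α} [M.Finite]

/-- A member's covering set `B ∪ {z}` with `z ∈ G ∖ cl B` is a shadow set with closure `G`. -/
theorem insert_mem_shadowAt {q : ℕ} {𝒜 : Finset (Finset α)} (h𝒜 : 𝒜 ⊆ Uq M (q + 2) q) {G : Finset α}
    (hG : G ∈ flatsQ M (q + 1)) {B : Finset α} (hB : B ∈ membersIn M 𝒜 G) {z : α} (hz : z ∈ G \ clF M B) :
    insert z B ∈ shadowAt M (q + 2) q 𝒜 G := by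
  rw [mem_membersIn] at hB
  rw [Finset.mem_sdiff] at hz
  have hGg : G ⊆ gr M := (mem_flatsQ.1 hG).1
  have hzg : z ∈ gr M := hGg hz.1
  have hY : insert z B ∈ Yq M (q + 2) q := insert_mem_Yq (h𝒜 hB.1) hzg hz.2
  rw [mem_shadowAt, mem_shadow]
  refine ⟨⟨hY, B, hB.1, Finset.subset_insert _ _⟩, ?_⟩
  have hsub : clF M (insert z B) ⊆ G := by
    rw [← Finset.coe_subset, coe_clF]
    have h1 : ((insert z B : Finset α) : Set α) ⊆ (G : Set α) := by
      rw [Finset.coe_insert]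
      exact Set.insert_subset (by exact_mod_cast hz.1)
        (by exact_mod_cast (subset_clF (h𝒜 hB.1)).trans hB.2)
    exact (M.closure_subset_closure h1).trans (mem_flatsQ.1 hG).2.1.closure.subset
  exact flat_eq_of_subset_of_eRk_eq hG (by rw [coe_clF]; exact M.isFlat_closure _) hsub
    (by rw [coe_clF, M.eRk_closure_eq]; exact eRk_eq_of_mem_Yq_diag hY)

open scoped Classical in
/-- **The covering bound at `G`**: `Σ_{B ∈ membersIn 𝒜 G} |G ∖ cl B| ≤ (q + 1) · #shadowAt 𝒜 G`. -/
theorem sum_card_sdiff_le_card_shadowAt {q : ℕ} {𝒜 : Finset (Finset α)} (h𝒜 : 𝒜 ⊆ Uq M (q + 2) q)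
    {G : Finset α} (hG : G ∈ flatsQ M (q + 1)) :
    ∑ B ∈ membersIn M 𝒜 G, (G \ clF M B).card ≤ (q + 1) * (shadowAt M (q + 2) q 𝒜 G).card := by
  set P : Finset (Σ _ : Finset α, α) := (membersIn M 𝒜 G).sigma (fun B => G \ clF M B) with hP
  let f : (Σ _ : Finset α, α) → Finset α := fun x => insert x.2 x.1
  have hmemP : ∀ x ∈ P, x.1 ∈ membersIn M 𝒜 G ∧ x.2 ∈ G \ clF M x.1 := by
    intro x hx
    rw [hP, Finset.mem_sigma] at hx
    exact hx
  have hPcard : P.card = ∑ B ∈ membersIn M 𝒜 G, (G \ clF M B).card := by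
    rw [hP, Finset.card_sigma]
  have himg : P.image f ⊆ shadowAt M (q + 2) q 𝒜 G := by
    intro S hS
    rw [Finset.mem_image] at hS
    obtain ⟨x, hx, rfl⟩ := hS
    obtain ⟨hx1, hx2⟩ := hmemP x hx
    exact insert_mem_shadowAt h𝒜 hG hx1 hx2
  have hfib : P.card ≤ (q + 1) * (P.image f).card := by
    apply Finset.card_le_mul_card_image
    intro S hS
    rw [Finset.mem_image] at hS
    obtain ⟨x0, hx0, rfl⟩ := hS
    obtain ⟨hx01, hx02⟩ := hmemP x0 hx0
    have hGg : G ⊆ gr M := (mem_flatsQ.1 hG).1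
    have hB0 : x0.1 ∈ Uq M (q + 2) q := h𝒜 (mem_membersIn.1 hx01).1
    have hz0 : x0.2 ∉ clF M x0.1 := (Finset.mem_sdiff.1 hx02).2
    have hSg : f x0 ⊆ gr M := Finset.insert_subset (hGg (Finset.mem_sdiff.1 hx02).1) (mem_Uq.1 hB0).1
    have hSr : M.eRk ((f x0 : Finset α) : Set α) = ((q + 1 : ℕ) : ℕ∞) := by
      have hS := insert_mem_shadowAt h𝒜 hG hx01 hx02
      rw [mem_shadowAt] at hS
      exact eRk_eq_of_mem_Yq_diag (shadow_subset_Yq _ hS.1)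
    have hinj : ((P.filter (fun x => f x = f x0)).card) ≤ (coloops M (f x0)).card := by
      apply Finset.card_le_card_of_injOn (fun x => x.2)
      · intro x hx
        rw [Finset.coe_filter] at hx
        obtain ⟨hxP, hxf⟩ := hx
        obtain ⟨hx1, hx2⟩ := hmemP x hxP
        have hx3 : x.2 ∉ clF M x.1 := (Finset.mem_sdiff.1 hx2).2
        have hzx : x.2 ∉ x.1 := notMem_of_notMem_clF (h𝒜 (mem_membersIn.1 hx1).1) hx3
        rw [Finset.mem_coe, mem_coloops]
        refine ⟨?_, ?_⟩
        · rw [← hxf]; exact Finset.mem_insert_self _ _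
        · have : (f x0).erase x.2 = x.1 := by
            rw [← hxf]
            exact Finset.erase_insert hzx
          rw [this]
          exact hx3
      · intro x hx y hy hxy
        rw [Finset.coe_filter] at hx hy
        obtain ⟨hxP, hxf⟩ := hx
        obtain ⟨hyP, hyf⟩ := hy
        obtain ⟨hx1, hx2⟩ := hmemP x hxP
        obtain ⟨hy1, hy2⟩ := hmemP y hyP
        have hzx : x.2 ∉ x.1 :=
          notMem_of_notMem_clF (h𝒜 (mem_membersIn.1 hx1).1) (Finset.mem_sdiff.1 hx2).2
        have hzy : y.2 ∉ y.1 :=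
          notMem_of_notMem_clF (h𝒜 (mem_membersIn.1 hy1).1) (Finset.mem_sdiff.1 hy2).2
        have hx' : x.1 = (f x0).erase x.2 := by rw [← hxf]; exact (Finset.erase_insert hzx).symm
        have hy' : y.1 = (f x0).erase y.2 := by rw [← hyf]; exact (Finset.erase_insert hzy).symm
        have hxy' : x.2 = y.2 := hxy
        have h1 : x.1 = y.1 := by rw [hx', hy', hxy']
        exact Sigma.ext h1 (heq_of_eq hxy')
    calc ((P.filter (fun x => f x = f x0)).card) ≤ (coloops M (f x0)).card := hinj
      _ ≤ q + 1 := card_coloops_le hSg hSr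
  calc ∑ B ∈ membersIn M 𝒜 G, (G \ clF M B).card = P.card := hPcard.symm
    _ ≤ (q + 1) * (P.image f).card := hfib
    _ ≤ (q + 1) * (shadowAt M (q + 2) q 𝒜 G).card :=
        Nat.mul_le_mul_left _ (Finset.card_le_card himg)

/-- **The local form at a flat whose carrying hyperplanes are thin.**  If every bottom set with closure inside
`G` has at least `q + 2` ground elements outside its closure, then `LocalShadowHall M q G` holds. -/
theorem localShadowHall_of_thin {q : ℕ} {G : Finset α} (hG : G ∈ flatsQ M (q + 1))
    (hthin : ∀ B ∈ Uq M (q + 2) q, clF M B ⊆ G → q + 2 ≤ (gr M \ clF M B).card) :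
    LocalShadowHall M q G := by
  classical
  intro 𝒜 h𝒜
  have hq1 : (0 : ℚ) < (q : ℚ) + 1 := by positivity
  have hq2 : (0 : ℚ) < (q : ℚ) + 2 := by positivity
  -- each local weight is at most |G ∖ cl B| / (q + 2)
  have hw : ∀ B ∈ membersIn M 𝒜 G, localWeight M B G ≤ ((G \ clF M B).card : ℚ) / ((q : ℚ) + 2) := by
    intro B hB
    rw [mem_membersIn] at hB
    have h := hthin B (h𝒜 hB.1) hB.2
    have h' : ((q : ℚ) + 2) ≤ ((gr M \ clF M B).card : ℚ) := by exact_mod_cast h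
    unfold localWeight
    exact div_le_div_of_nonneg_left (by positivity) hq2 h'
  have hcov := sum_card_sdiff_le_card_shadowAt h𝒜 hG
  have hcov' : (∑ B ∈ membersIn M 𝒜 G, ((G \ clF M B).card : ℚ)) ≤
      ((q : ℚ) + 1) * ((shadowAt M (q + 2) q 𝒜 G).card : ℚ) := by exact_mod_cast hcov
  calc (((q : ℚ) + 2) / ((q : ℚ) + 1)) * ∑ B ∈ membersIn M 𝒜 G, localWeight M B G
      ≤ (((q : ℚ) + 2) / ((q : ℚ) + 1)) * ∑ B ∈ membersIn M 𝒜 G, ((G \ clF M B).card : ℚ) / ((q : ℚ) + 2) := by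
        apply mul_le_mul_of_nonneg_left (Finset.sum_le_sum hw) (by positivity)
    _ = (∑ B ∈ membersIn M 𝒜 G, ((G \ clF M B).card : ℚ)) / ((q : ℚ) + 1) := by
        rw [← Finset.sum_div]
        field_simp
    _ ≤ ((shadowAt M (q + 2) q 𝒜 G).card : ℚ) := by
        rw [div_le_iff₀ hq1]
        linarith

end PercRepro.Shadow
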